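import Mathlib.RingTheory.DedekindDomain.AdicValuation
import Mathlib.RingTheory.LocalRing.ResidueField.Basic
import HarnessLib

/-!
# The residue field of `O_v` is `A ⧸ v`

Let `A` be a Dedekind domain with fraction field `K`, `v` a finite place and
`O_v = v.adicCompletionIntegers K ⊆ K_v = v.adicCompletion K` (as types, `O_v` is Mathlib's
`𝒪[K_v]` and its residue field `IsLocalRing.ResidueField O_v` is `𝓀[K_v]`, both by `rfl`). This
file identifies the residue field of the complete discrete valuation ring `O_v` with the residue
field `A ⧸ v` of `A` at `v` (Serre, *Local Fields*, Ch. II §1; Neukirch, *Algebraic Number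
Theory*, II.4: completion does not change the residue field), for an arbitrary Dedekind domain:

* `exists_sub_algebraMap_mem_maximalIdeal` : every `y ∈ O_v` is congruent modulo `𝔪_v` to (the
  image of) an element of `A` — `K` is dense in `K_v` (Mathlib `denseRange_algebraMap`) and a
  `v`-integer of `K` is approximated by `A` (Mathlib `exists_valuation_sub_lt_of_integer`);
* `residue_algebraMap_eq_zero_iff` : `A → O_v → κ(O_v)` has kernel `v`;
* `residue_comp_algebraMap_surjective`, `residueFieldEquiv : A ⧸ v ≃+* κ(O_v)`;
* consequences: the instances `finite_residueField_adicCompletionIntegers`,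
  `finite_residueField_adicCompletion` (`Finite (A ⧸ v)` gives `Finite κ(O_v)`, in both the
  `ResidueField (v.adicCompletionIntegers K)` and the `𝓀[v.adicCompletion K]` presentation; for
  the ring of integers of a number field `Finite (𝓞 K ⧸ v)` is Mathlib's instance in
  `Mathlib.NumberTheory.NumberField.Ideal.Basic`, so the instances fire in files importing it),
  and the cardinality statements `natCard_residueField_adicCompletionIntegers`,
  `natCard_residueField_adicCompletion`.

Existing special cases in the tree that this file supersedes (librarian: candidates for
retirement/re-derivation): `Literature.NumberTheory.Automorphic.exists_ringOfIntegers_valued_sub_lt_one` and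
`Literature.NumberTheory.Automorphic.finite_residueField_adicCompletion` (`Automorphic/AdicCompletionCompact.lean`,
number fields), `natCard_residueField_adicCompletion_le` / `_le_residueCard`
(`Automorphic/SatakeParameterTrivialBound.lean`, now equalities),
`Literature.NumberTheory.DiophantineGeometry.Rat.finite_residueField_adicCompletionIntegers` (`DiophantineGeometry/Conductor.lean`, `ℚ`),
`WeierstrassCurve.natCard_residueField_adicCompletionIntegers`
(`EllipticCurves/LFunctionPrimeCoeff.lean`, `ℚ`; same short name as the general statement here,
in a different namespace), and the kernel computation
`IsDedekindDomain.HeightOneSpectrum.ker_residue_comp_algebraMap_adicCompletionIntegers`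
(`EllipticCurves/AnalyticRankLSeriesSummableProofs.lean`).

## References

* J.-P. Serre, *Local Fields*, GTM 67, Springer (1979), Ch. II §1.
* J. Neukirch, *Algebraic Number Theory*, Grundlehren 322, Springer (1999), Ch. II §4
  (Prop. 4.3: `O/𝔭ⁿ ≅ Ô/𝔭̂ⁿ`).
-/

noncomputable section

open IsLocalRing Valued

namespace IsDedekindDomain.HeightOneSpectrum

variable {A : Type*} [CommRing A] [IsDedekindDomain A] (K : Type*) [Field K] [Algebra A K]
  [IsFractionRing A K] (v : HeightOneSpectrum A)

/-- The image in `O_v` of `r ∈ A` has valuation `< 1` iff `r ∈ v`, i.e. `r ↦ residue class` has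
kernel `v`: `residue (algebraMap A O_v r) = 0 ↔ r ∈ v`. [folklore] -/
theorem residue_algebraMap_eq_zero_iff (r : A) :
    residue (v.adicCompletionIntegers K) (algebraMap A (v.adicCompletionIntegers K) r) = 0 ↔
      r ∈ v.asIdeal := by
  rw [residue_eq_zero_iff, mem_maximalIdeal, mem_nonunits_iff,
    adicCompletionIntegers.isUnit_iff_valued_eq_one, algebraMap_adicCompletionIntegers_apply,
    valuedAdicCompletion_eq_valuation', valuation_of_algebraMap]
  constructor
  · intro h
    by_contra hr
    exact h (intValuation_eq_one_iff.mpr hr)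
  · intro hr
    exact ((intValuation_lt_one_iff_mem v r).mpr hr).ne

/-- **Density**: every element of `O_v` is congruent modulo the maximal ideal `𝔪_v` to an element
of `A`. Proof: `K` is dense in `K_v` (Mathlib `denseRange_algebraMap`) and the ball
`{z : v(z - y) < 1}` is open, so it contains some `k ∈ K`; then `v(k) ≤ 1` and `k` is within
valuation `< 1` of some `c ∈ A` (Mathlib `exists_valuation_sub_lt_of_integer`), whence
`v(y - c) < 1`. (Serre, *Local Fields*, II §1; the number-field case is
`Literature.NumberTheory.Automorphic.exists_ringOfIntegers_valued_sub_lt_one`.) [folklore] -/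
theorem exists_sub_algebraMap_mem_maximalIdeal (y : v.adicCompletionIntegers K) :
    ∃ c : A, y - algebraMap A (v.adicCompletionIntegers K) c ∈
      maximalIdeal (v.adicCompletionIntegers K) := by
  -- Step 1: `k ∈ K` with `v(y - k) < 1`
  have hopen : IsOpen {z : v.adicCompletion K | Valued.v (z - (y : v.adicCompletion K)) < 1} := by
    have h1 : IsOpen {x : v.adicCompletion K |
        Valued.v.restrict x < Valued.v.restrict (1 : v.adicCompletion K)} :=
      Valued.isOpen_ball _ _
    simp only [Valuation.restrict_lt_iff] at h1
    simp only [map_one] at h1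
    exact h1.preimage (continuous_sub_right _)
  obtain ⟨k, hk⟩ := (denseRange_algebraMap K v).exists_mem_open hopen
    ⟨(y : v.adicCompletion K), by simp⟩
  rw [Set.mem_setOf_eq, Valuation.map_sub_swap] at hk
  -- Step 2: `v(k) ≤ 1`, so `k` is close to some `c ∈ A`
  have hval : ∀ x : K, Valued.v (algebraMap K (v.adicCompletion K) x) = v.valuation K x :=
    fun x ↦ valuedAdicCompletion_eq_valuation' v x
  have hk1 : v.valuation K k ≤ 1 := by
    rw [← hval]
    have hy : Valued.v (y : v.adicCompletion K) ≤ 1 := y.2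
    calc Valued.v (algebraMap K (v.adicCompletion K) k)
        = Valued.v ((y : v.adicCompletion K) - ((y : v.adicCompletion K) - algebraMap K _ k)) := by
          rw [sub_sub_cancel]
      _ ≤ max (Valued.v (y : v.adicCompletion K))
          (Valued.v ((y : v.adicCompletion K) - algebraMap K _ k)) := Valuation.map_sub _ _ _
      _ ≤ 1 := max_le hy hk.le
  obtain ⟨c, hc⟩ := v.exists_valuation_sub_lt_of_integer hk1 1
  refine ⟨c, ?_⟩
  -- Step 3: `v(y - c) ≤ max (v(y - k), v(k - c)) < 1`
  rw [mem_maximalIdeal, mem_nonunits_iff, adicCompletionIntegers.isUnit_iff_valued_eq_one]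
  change Valued.v ((y - algebraMap A (v.adicCompletionIntegers K) c :
    v.adicCompletionIntegers K) : v.adicCompletion K) ≠ 1
  rw [AddSubgroupClass.coe_sub, algebraMap_adicCompletionIntegers_apply A K v c]
  have h2 : Valued.v (algebraMap K (v.adicCompletion K) k -
      (algebraMap A K c : v.adicCompletion K)) < 1 := by
    rw [Valuation.map_sub_swap, show ((algebraMap A K c : K) : v.adicCompletion K) =
      algebraMap K (v.adicCompletion K) (algebraMap A K c) from rfl, ← map_sub, hval]
    exact_mod_cast hc
  have h := Valuation.map_add_lt Valued.v hk h2
  rw [sub_add_sub_cancel] at h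
  exact h.ne

/-- The composite `A → O_v → κ(O_v)` onto the residue field of `O_v` is surjective
(`exists_sub_algebraMap_mem_maximalIdeal`). [folklore] -/
theorem residue_comp_algebraMap_surjective :
    Function.Surjective ((residue (v.adicCompletionIntegers K)).comp
      (algebraMap A (v.adicCompletionIntegers K))) := by
  intro x
  obtain ⟨y, rfl⟩ := residue_surjective x
  obtain ⟨c, hc⟩ := exists_sub_algebraMap_mem_maximalIdeal K v y
  refine ⟨c, ?_⟩
  rw [RingHom.comp_apply, eq_comm, ← sub_eq_zero, ← map_sub, residue_eq_zero_iff]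
  exact hc

/-- The kernel of `A → κ(O_v)` is `v` (cf. the copy
`ker_residue_comp_algebraMap_adicCompletionIntegers` in
`Literature/NumberTheory/EllipticCurves/AnalyticRankLSeriesSummableProofs.lean`). [folklore] -/
theorem ker_residue_comp_algebraMap :
    RingHom.ker ((residue (v.adicCompletionIntegers K)).comp
      (algebraMap A (v.adicCompletionIntegers K))) = v.asIdeal := by
  ext r
  rw [RingHom.mem_ker, RingHom.comp_apply, residue_algebraMap_eq_zero_iff]

/-- **The residue field of the completion is the residue field**: `A ⧸ v ≃+* κ(O_v)`, induced by
`A → O_v` (Serre, *Local Fields*, II §1; Neukirch II.4.3). [folklore] -/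
def residueFieldEquiv : A ⧸ v.asIdeal ≃+* ResidueField (v.adicCompletionIntegers K) :=
  (Ideal.quotEquivOfEq (ker_residue_comp_algebraMap K v).symm).trans
    (RingHom.quotientKerEquivOfSurjective (residue_comp_algebraMap_surjective K v))

/-- `residueFieldEquiv` on classes of elements of `A`: the class of `r` goes to the residue of
`algebraMap A O_v r`. [folklore] -/
@[simp]
theorem residueFieldEquiv_apply_mk (r : A) :
    residueFieldEquiv K v (Ideal.Quotient.mk v.asIdeal r) =
      residue (v.adicCompletionIntegers K) (algebraMap A (v.adicCompletionIntegers K) r) := by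
  simp [residueFieldEquiv, RingHom.quotientKerEquivOfSurjective_apply_mk]

/-- The residue field of `O_v` is finite as soon as `A ⧸ v` is (e.g. for the ring of integers of a
number field). New `Prop`-valued instance (none in Mathlib at the pin). [folklore] -/
instance finite_residueField_adicCompletionIntegers [Finite (A ⧸ v.asIdeal)] :
    Finite (ResidueField (v.adicCompletionIntegers K)) :=
  Finite.of_equiv _ (residueFieldEquiv K v).toEquiv

/-- The same instance keyed to Mathlib's `𝓀[K_v]` presentation of the residue field of the valued
field `K_v` (`𝓀[v.adicCompletion K] = ResidueField (v.adicCompletionIntegers K)` by `rfl`), the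
form used by Mathlib's compactness criterion and by `Automorphic/AdicCompletionCompact.lean`.
[folklore] -/
instance finite_residueField_adicCompletion [Finite (A ⧸ v.asIdeal)] :
    Finite 𝓀[v.adicCompletion K] :=
  finite_residueField_adicCompletionIntegers K v

/-- `|κ(O_v)| = |A ⧸ v|` (`= N v` for number fields). [folklore] -/
theorem natCard_residueField_adicCompletionIntegers :
    Nat.card (ResidueField (v.adicCompletionIntegers K)) = Nat.card (A ⧸ v.asIdeal) :=
  (Nat.card_congr (residueFieldEquiv K v).toEquiv).symm

/-- `|𝓀[K_v]| = |A ⧸ v|`, the `𝓀[·]` form of `natCard_residueField_adicCompletionIntegers`.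
[folklore] -/
theorem natCard_residueField_adicCompletion :
    Nat.card 𝓀[v.adicCompletion K] = Nat.card (A ⧸ v.asIdeal) :=
  natCard_residueField_adicCompletionIntegers K v

end IsDedekindDomain.HeightOneSpectrum
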